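import Summits.Ventures.Crystal3D.Kissing125.Geometry1
import HarnessLib

/-!
# The class `𝒱(5/2)`, its `KConf` at `κ = 7/32`, and rigidity at `σ = 7/8` — K25 copy at `κ = 7/32` (`h = 5/4`), part 2/4

HONEST FRAMING (cell pub-crystal3d, K-path at `h = 5/4`): this is NOT a result printed by Hales.  It is his
METHOD (arXiv:1209.6043, Theorem 3: the main estimate + the classification of the contact graphs of kissing
configurations, in the tree's form of a verified interval-arithmetic growth search, `Literature/…/KissingSearch*.lean`)
RE-RUN at the separation `5/2` instead of `2h₀ = 2.52` (largest long-side cosine `κ = 1 − (5/4)²/2 = 7/32` instead of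
`κ₀ = 1031/5000`).  The declarations are namespace-shadowing COPIES of the tree's declarations (same names, inside
`namespace Summit.Ventures.Crystal3D.Kissing125[.KissingSearch]`, original docstrings and citation tags kept — the tags
name the printed METHOD step each declaration implements); the diff to the originals is stated per file.  Generated by
`HOME/lean/kissing125/gen/mkfiles.py`; audit recipe in `HOME/lean/kissing125/README.md`.  Nothing here is asserted
about GAP(1.26) or any census.

THIS FILE: (a) the predicate `IsKissingConfig25` (= `IsGapKissingConfig (5/2)` of `Bulk/GapReduction.lean`, same shape) with its `V/2` bookkeeping (copies of `FejesTothKissingTwelve` / `KissingFacetPenalty` Part C lemmas, separation `⟪·,·⟫ = 1/2 ∨ ≤ 7/32`); (b) `≤ 4` contacts at a point: copy of `KissingNodeDegree` Part D with `2h₀ ↦ 5/2` (numeric input `1 − (5/2)²/6 = −1/24 < 17/81`) and of `KissingUnitContactDegree`; (c) the geometric dictionary: copy of `KissingSearchGeometry.lean` (`IsKissingConfig ↦ IsKissingConfig25`, the structure `KConf` being the 7/32 one of `SearchDefs`), ending in `contactGraphFccOrHcp25_of_forall_concl`; (d) Lemma 10 at `σ = 4 − 2(5/4)² = 7/8 <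 8/9`: copy of `isArrangedIn_of_contactGraph_iso` (+ FCC/HCP corollaries) on the tree's generic `IsRealization` rigidity, and `isArrangedIn_of_forall_concl25`.  (Part 2 of 4: lines 277–513 of the transformed copy; the split is only for the 400-line rule.)
  v3.1 (gate `dedup.landed`): the generic lemma `triAngleAt_le_pi'` of `Literature/Geometry/DiscreteGeometry/KissingSearchGeometry.lean` is NOT re-declared (a verbatim copy would restate the tree's declaration).
  v3.3 (same lint): the generic lemma `KissingSearch.Pfun_pos_of_three_tight` of `Literature/Geometry/DiscreteGeometry/KissingSearchGeometry.lean` is NOT re-declared (its statement is a verbatim copy; the K25 `Pfun` of `SearchDefs1` is definitionally the tree's `Pfun`).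

## References
* T. C. Hales, *A proof of Fejes Tóth's conjecture on sphere packings with kissing number twelve*,
  arXiv:1209.6043 (2012): Definition 1, Theorem 2 (main estimate `d₃`), Theorem 3, Lemmas 7–10. [`Hales2012`]
* R. E. Moore, *Interval Analysis* (1966), Theorem 3.1, §4.4. [`Moore1966`]
-/

noncomputable section

namespace Summit.Ventures.Crystal3D.Kissing125
open Literature.Geometry.DiscreteGeometry
open Real RealInnerProductSpace InnerProductGeometry Finset

namespace KissingSearch
open Real RealInnerProductSpace Finset

section Geometry

end Geometry

end KissingSearch

section Dictionary

open Real RealInnerProductSpace Finset Kissing125.KissingSearch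


/-! ### Part B. The labelling of the unit configuration -/

variable {S : Set (EuclideanSpace ℝ (Fin 3))}

/-- The labelling `V/2 ≃ Fin 12`. [folklore] -/
def IsKissingConfig25.labEquiv (hS : IsKissingConfig25 S) : {x // x ∈ hS.unitConfig} ≃ Fin 12 :=
  hS.unitConfig.equivFin.trans (finCongr hS.card_unitConfig)

/-- **The label of a point** (`0` off the configuration). [folklore] -/
def IsKissingConfig25.lab (hS : IsKissingConfig25 S) (x : (EuclideanSpace ℝ (Fin 3))) : ℕ :=
  if hx : x ∈ hS.unitConfig then (hS.labEquiv ⟨x, hx⟩ : ℕ) else 0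

/-- **The point of a label** (`0` for labels `≥ 12`). [folklore] -/
def IsKissingConfig25.pt (hS : IsKissingConfig25 S) (a : ℕ) : (EuclideanSpace ℝ (Fin 3)) :=
  if ha : a < 12 then ((hS.labEquiv.symm ⟨a, ha⟩ : {x // x ∈ hS.unitConfig}) : (EuclideanSpace ℝ (Fin 3))) else 0

/-- Points of labels are points of the configuration. [folklore] -/
theorem IsKissingConfig25.pt_mem (hS : IsKissingConfig25 S) {a : ℕ} (ha : a < 12) : hS.pt a ∈ hS.unitConfig := by
  unfold IsKissingConfig25.pt; rw [dif_pos ha]; exact (hS.labEquiv.symm ⟨a, ha⟩).2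

/-- Labels are `< 12`. [folklore] -/
theorem IsKissingConfig25.lab_lt (hS : IsKissingConfig25 S) (x : (EuclideanSpace ℝ (Fin 3))) : hS.lab x < 12 := by
  unfold IsKissingConfig25.lab; split_ifs
  · exact (hS.labEquiv _).2
  · norm_num

/-- `lab ∘ pt = id` on labels `< 12`. [folklore] -/
theorem IsKissingConfig25.lab_pt (hS : IsKissingConfig25 S) {a : ℕ} (ha : a < 12) : hS.lab (hS.pt a) = a := by
  unfold IsKissingConfig25.lab
  rw [dif_pos (hS.pt_mem ha)]
  unfold IsKissingConfig25.pt
  simp only [dif_pos ha, Subtype.coe_eta, Equiv.apply_symm_apply]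

/-- `pt ∘ lab = id` on the configuration. [folklore] -/
theorem IsKissingConfig25.pt_lab (hS : IsKissingConfig25 S) {x : (EuclideanSpace ℝ (Fin 3))} (hx : x ∈ hS.unitConfig) : hS.pt (hS.lab x) = x := by
  unfold IsKissingConfig25.pt
  rw [dif_pos (hS.lab_lt x)]
  unfold IsKissingConfig25.lab
  simp only [dif_pos hx, Fin.eta, Equiv.symm_apply_apply]

/-- `pt` is injective on labels `< 12`. [folklore] -/
theorem IsKissingConfig25.pt_inj (hS : IsKissingConfig25 S) {a b : ℕ} (ha : a < 12) (hb : b < 12)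
    (h : hS.pt a = hS.pt b) : a = b := by
  rw [← hS.lab_pt ha, ← hS.lab_pt hb, h]

/-- Points of labels are unit vectors. [folklore] -/
theorem IsKissingConfig25.norm_pt (hS : IsKissingConfig25 S) {a : ℕ} (ha : a < 12) : ‖hS.pt a‖ = 1 :=
  hS.norm_of_mem_unitConfig (hS.pt_mem ha)

/-- Membership in the label set of a set of points. [folklore] -/
theorem IsKissingConfig25.mem_image_lab (hS : IsKissingConfig25 S) {t : Finset (EuclideanSpace ℝ (Fin 3))} (ht : t ⊆ hS.unitConfig)
    {a : ℕ} : a ∈ t.image hS.lab ↔ a < 12 ∧ hS.pt a ∈ t := by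
  rw [Finset.mem_image]
  constructor
  · rintro ⟨x, hx, rfl⟩
    exact ⟨hS.lab_lt x, by rw [hS.pt_lab (ht hx)]; exact hx⟩
  · rintro ⟨ha, hm⟩
    exact ⟨hS.pt a, hm, hS.lab_pt ha⟩

/-- The point set of the label set of `t ⊆ V/2` is `t`. [folklore] -/
theorem IsKissingConfig25.image_pt_image_lab (hS : IsKissingConfig25 S) {t : Finset (EuclideanSpace ℝ (Fin 3))} (ht : t ⊆ hS.unitConfig) :
    (t.image hS.lab).image hS.pt = t := by
  rw [Finset.image_image]
  conv_rhs => rw [← Finset.image_id (s := t)]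
  exact Finset.image_congr fun x hx => hS.pt_lab (ht (Finset.mem_coe.1 hx))

/-- The label set of the point set of `tl ⊆ {0 … 11}` is `tl`. [folklore] -/
theorem IsKissingConfig25.image_lab_image_pt (hS : IsKissingConfig25 S) {tl : Finset ℕ} (htl : ∀ a ∈ tl, a < 12) :
    (tl.image hS.pt).image hS.lab = tl := by
  rw [Finset.image_image]
  conv_rhs => rw [← Finset.image_id (s := tl)]
  exact Finset.image_congr fun a ha => hS.lab_pt (htl a (Finset.mem_coe.1 ha))

/-- `lab` is injective on the configuration. [folklore] -/
theorem IsKissingConfig25.lab_injOn (hS : IsKissingConfig25 S) : Set.InjOn hS.lab (hS.unitConfig : Set (EuclideanSpace ℝ (Fin 3))) :=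
  fun x hx x' hx' h => by rw [← hS.pt_lab (Finset.mem_coe.1 hx), ← hS.pt_lab (Finset.mem_coe.1 hx'), h]

/-- Label sets have the same cardinality. [folklore] -/
theorem IsKissingConfig25.card_image_lab (hS : IsKissingConfig25 S) {t : Finset (EuclideanSpace ℝ (Fin 3))} (ht : t ⊆ hS.unitConfig) :
    (t.image hS.lab).card = t.card :=
  Finset.card_image_of_injOn fun _ hx _ hx' h => hS.lab_injOn (ht (Finset.mem_coe.1 hx)) (ht (Finset.mem_coe.1 hx')) h

/-- Taking label sets is injective on subsets of the configuration. [folklore] -/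
theorem IsKissingConfig25.eq_of_image_lab_eq (hS : IsKissingConfig25 S) {t t' : Finset (EuclideanSpace ℝ (Fin 3))} (ht : t ⊆ hS.unitConfig)
    (ht' : t' ⊆ hS.unitConfig) (h : t.image hS.lab = t'.image hS.lab) : t = t' := by
  rw [← hS.image_pt_image_lab ht, ← hS.image_pt_image_lab ht', h]

/-! ### Part C. The `KConf` of a kissing configuration -/

/-- **The labelled fan triangles.** [folklore] -/
def IsKissingConfig25.kT (hS : IsKissingConfig25 S) : Finset (Finset ℕ) :=
  (fanTriSets hS.unitConfig).image fun t => t.image hS.lab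

/-- **The labelled angles**: the angle of the fan triangle with label set `tl` at the label
`v` (`0` if `v ∉ tl`). [folklore] -/
def IsKissingConfig25.kang (hS : IsKissingConfig25 S) (tl : Finset ℕ) (v : ℕ) : ℝ :=
  if v ∈ tl then triAngleAt hS.unitConfig (tl.image hS.pt) (hS.pt v) else 0

/-- Membership in `kT`. [folklore] -/
theorem IsKissingConfig25.mem_kT (hS : IsKissingConfig25 S) {tl : Finset ℕ} :
    tl ∈ hS.kT ↔ tl.image hS.pt ∈ fanTriSets hS.unitConfig ∧ ∀ a ∈ tl, a < 12 := by
  have hX1 : ∀ y ∈ hS.unitConfig, ‖y‖ = 1 := fun _ hy => hS.norm_of_mem_unitConfig hy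
  unfold IsKissingConfig25.kT
  rw [Finset.mem_image]
  constructor
  · rintro ⟨t, ht, rfl⟩
    rw [hS.image_pt_image_lab (subset_of_mem_fanTriSets hX1 ht)]
    exact ⟨ht, fun a ha => (Finset.mem_image.1 ha).elim fun x hx => hx.2 ▸ hS.lab_lt x⟩
  · rintro ⟨ht, htl⟩
    exact ⟨tl.image hS.pt, ht, hS.image_lab_image_pt htl⟩

/-- For a labelled fan triangle, membership of labels is membership of points. [folklore] -/
theorem IsKissingConfig25.mem_of_mem_kT (hS : IsKissingConfig25 S) {tl : Finset ℕ} (htl : tl ∈ hS.kT) {a : ℕ}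
    (ha : a < 12) : a ∈ tl ↔ hS.pt a ∈ tl.image hS.pt := by
  constructor
  · exact fun h => Finset.mem_image_of_mem _ h
  · intro h
    obtain ⟨b, hb, hba⟩ := Finset.mem_image.1 h
    rwa [← hS.pt_inj ((hS.mem_kT.1 htl).2 b hb) ha hba]

/-- The label set of a fan triangle is in `kT`, with the expected members. [folklore] -/
theorem IsKissingConfig25.image_lab_mem_kT (hS : IsKissingConfig25 S) {t : Finset (EuclideanSpace ℝ (Fin 3))} (ht : t ∈ fanTriSets hS.unitConfig) :
    t.image hS.lab ∈ hS.kT :=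
  Finset.mem_image_of_mem _ ht

/-- The labelled angle on the label set of a fan triangle. [folklore] -/
theorem IsKissingConfig25.kang_image_lab (hS : IsKissingConfig25 S) {t : Finset (EuclideanSpace ℝ (Fin 3))} (ht : t ∈ fanTriSets hS.unitConfig)
    {v : ℕ} (hv : v < 12) : hS.kang (t.image hS.lab) v = triAngleAt hS.unitConfig t (hS.pt v) := by
  have hX1 : ∀ y ∈ hS.unitConfig, ‖y‖ = 1 := fun _ hy => hS.norm_of_mem_unitConfig hy
  have htX := subset_of_mem_fanTriSets hX1 ht
  unfold IsKissingConfig25.kang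
  rw [hS.image_pt_image_lab htX]
  split_ifs with h
  · rfl
  · rw [hS.mem_image_lab htX] at h
    exact (triAngleAt_eq_zero_of_not_mem fun hm => h ⟨hv, hm⟩).symm

/-- A labelled fan triangle with three given distinct labels is their set. [folklore] -/
theorem IsKissingConfig25.image_pt_eq_triple (hS : IsKissingConfig25 S) {tl : Finset ℕ} (htl : tl ∈ hS.kT)
    {v a b : ℕ} (hv : v ∈ tl) (ha : a ∈ tl) (hb : b ∈ tl) (hva : v ≠ a) (hvb : v ≠ b) (hab : a ≠ b) :
    tl.image hS.pt = {hS.pt v, hS.pt a, hS.pt b} := by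
  have hX1 : ∀ y ∈ hS.unitConfig, ‖y‖ = 1 := fun _ hy => hS.norm_of_mem_unitConfig hy
  obtain ⟨ht, hlt⟩ := hS.mem_kT.1 htl
  have h3 := card_eq_three_of_mem_fanTriSets hX1 ht
  have nva : hS.pt v ≠ hS.pt a := fun h => hva (hS.pt_inj (hlt v hv) (hlt a ha) h)
  have nvb : hS.pt v ≠ hS.pt b := fun h => hvb (hS.pt_inj (hlt v hv) (hlt b hb) h)
  have nab : hS.pt a ≠ hS.pt b := fun h => hab (hS.pt_inj (hlt a ha) (hlt b hb) h)
  symm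
  apply Finset.eq_of_subset_of_card_le
  · intro x hx
    simp only [Finset.mem_insert, Finset.mem_singleton] at hx
    rcases hx with rfl | rfl | rfl
    · exact Finset.mem_image_of_mem _ hv
    · exact Finset.mem_image_of_mem _ ha
    · exact Finset.mem_image_of_mem _ hb
  · rw [h3, Finset.card_insert_of_notMem, Finset.card_pair nab]
    simp only [Finset.mem_insert, Finset.mem_singleton, not_or]
    exact ⟨nva, nvb⟩

end Dictionary
end Summit.Ventures.Crystal3D.Kissing125
end
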